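import Mathlib
import Summits.MatrixMultiplication.MatrixMultiplication.Theorems.SnSubsetDichotomyHyperoctahedralThresholdRotationIdentity

/-!
# Bounds for the secondary twin counts `S₁`, `RInc`, `Dp` by poorness and per-vertex closed-walk counts
(crux `SnSubsetDichotomy.HyperoctahedralThreshold`, stmt-MatrixMultiplication-10883; siege seat k18, variation "twins ℓ² argument";
`--supports` helper, companion of `…TwinDefects` / `…TwinsEll2` / `…TwinsEll2Bulk`)

Vocabulary: involutions `μ c` of `Fin n`, `x · z := z.foldl (fun v c => μ c v) x`; cyclically reduced words of length `ℓ` as the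
filtered image of `List.Vector (Fin 3) ℓ`; `cw_m(p)` = number of REDUCED words of length `m` closing at `p` (written out as a
filtered image of `List.Vector (Fin 3) m`; = `|TwinSupplyCS.closedAt μ m p|` of siege k26).  The twins ℓ² reductions (`stub_twinsEll2`, `stub_twinsEll2Bulk`) leave four counts at one length `ℓ`; this file bounds the
three SECONDARY ones by two scalar parameters of the host — POORNESS `N ≥ max_z |Fix z|` (the core's hypothesis gives
`N = (4ℓ²)^{⌊log₂ℓ⌋+1}(|R|+1)`) and the DENSE-VERTEX count `M ≥ max_x #{z cyclically reduced of length ℓ : x · z = x}`: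

* `s1_le_ret`:   `S₁ ≤ (N − 1) · Ret`,  `Ret := #{(z, d, p) : 0 < d < ℓ, p · z = p, p · z.take d = p}` (returns);
* `ret_le_sum`:  `Ret ≤ Σ_{d<ℓ} Σ_p cw_d(p) · cw_{ℓ−d}(p)`  (a return splits the word into two closed reduced walks);
* `rinc_le`:     `RInc ≤ |R| · (M · (N − 1))`;
* `pv_le`:       `#{(z, y) : (z, v, y) a twin pre-pair} ≤ M · (N − 1)` for every vertex `v` (the `Dp` of the bulk form).

So, after these files, the twins route to the open core needs exactly: a supply lower bound for `Pairs` (k22/k26), smallness of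
`M` off a removable set (dense vertices / surgery), and the slide bound `ℓ · Ξ < Pairs / 2` — (WM), the open atom.
Pure finite combinatorics; no hypothesis on `μ` at all except where stated; no definitions.
-/

set_option linter.dupNamespace false

namespace Summit.MatrixMultiplication.MatrixMultiplication.Theorems.HyperoctahedralThreshold

namespace TwinsEll2

open Finset Rotation

variable {n : ℕ}

/-- **`S₁ ≤ (N − 1) · Ret`.**  Each return `(z, d, p)` carries at most `|Fix z| − 1 ≤ N − 1` other fixed points `y`. -/
theorem s1_le_ret (μ : Fin 3 → Equiv.Perm (Fin n)) (ℓ N : ℕ)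
    (hN : ∀ z ∈ ((univ : Finset (List.Vector (Fin 3) ℓ)).image (fun v => v.toList)).filter
        (fun z => List.IsChain (· ≠ ·) (z ++ z)),
      ((univ : Finset (Fin n)).filter (fun x => z.foldl (fun v c => μ c v) x = x)).card ≤ N) :
    (((((univ : Finset (List.Vector (Fin 3) ℓ)).image (fun v => v.toList)).filter
        (fun z => List.IsChain (· ≠ ·) (z ++ z))) ×ˢ range ℓ ×ˢ (univ : Finset (Fin n)) ×ˢ
        (univ : Finset (Fin n))).filter (fun t =>
          0 < t.2.1 ∧ t.1.foldl (fun v c => μ c v) t.2.2.1 = t.2.2.1 ∧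
          (t.1.take t.2.1).foldl (fun v c => μ c v) t.2.2.1 = t.2.2.1 ∧
          t.1.foldl (fun v c => μ c v) t.2.2.2 = t.2.2.2 ∧ t.2.2.2 ≠ t.2.2.1)).card ≤
      (N - 1) * (((((univ : Finset (List.Vector (Fin 3) ℓ)).image (fun v => v.toList)).filter
        (fun z => List.IsChain (· ≠ ·) (z ++ z))) ×ˢ range ℓ ×ˢ (univ : Finset (Fin n))).filter (fun t =>
          0 < t.2.1 ∧ t.1.foldl (fun v c => μ c v) t.2.2 = t.2.2 ∧
          (t.1.take t.2.1).foldl (fun v c => μ c v) t.2.2 = t.2.2)).card := by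
  classical
  set W := ((univ : Finset (List.Vector (Fin 3) ℓ)).image (fun v => v.toList)).filter
    (fun z => List.IsChain (· ≠ ·) (z ++ z)) with hW
  set S := ((W ×ˢ range ℓ ×ˢ (univ : Finset (Fin n)) ×ˢ (univ : Finset (Fin n))).filter (fun t =>
    0 < t.2.1 ∧ t.1.foldl (fun v c => μ c v) t.2.2.1 = t.2.2.1 ∧
    (t.1.take t.2.1).foldl (fun v c => μ c v) t.2.2.1 = t.2.2.1 ∧
    t.1.foldl (fun v c => μ c v) t.2.2.2 = t.2.2.2 ∧ t.2.2.2 ≠ t.2.2.1)) with hS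
  set Ret := ((W ×ˢ range ℓ ×ˢ (univ : Finset (Fin n))).filter (fun t =>
    0 < t.2.1 ∧ t.1.foldl (fun v c => μ c v) t.2.2 = t.2.2 ∧
    (t.1.take t.2.1).foldl (fun v c => μ c v) t.2.2 = t.2.2)) with hRet
  -- fibre over the return `(z, d, p)`
  have hfib : ∀ r ∈ Ret, (S.filter (fun t => (t.1, t.2.1, t.2.2.1) = r)).card ≤ N - 1 := by
    rintro ⟨z, d, p⟩ hr
    rw [hRet, mem_filter] at hr
    obtain ⟨hmem, -, hp, -⟩ := hr
    simp only [mem_product, mem_univ, and_true, mem_range] at hmem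
    obtain ⟨hz, -⟩ := hmem
    dsimp only at hp hz
    -- the fibre injects into `Fix z \ {p}` via `t ↦ y`
    have hsub : (S.filter (fun t => (t.1, t.2.1, t.2.2.1) = ((z, d, p) : List (Fin 3) × ℕ × Fin n))).card ≤
        (((univ : Finset (Fin n)).filter (fun x => z.foldl (fun v c => μ c v) x = x)).erase p).card := by
      refine card_le_card_of_injOn (fun t => t.2.2.2) ?_ ?_
      · rintro ⟨z', d', p', y⟩ h
        rw [mem_coe, mem_filter, hS, mem_filter] at h
        obtain ⟨⟨-, -, -, -, hy, hyp⟩, heq⟩ := h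
        simp only [Prod.mk.injEq] at heq
        obtain ⟨rfl, rfl, rfl⟩ := heq
        dsimp only at hy hyp ⊢
        rw [mem_coe, mem_erase, mem_filter]
        exact ⟨hyp, mem_univ _, hy⟩
      · rintro ⟨z₁, d₁, p₁, y₁⟩ h₁ ⟨z₂, d₂, p₂, y₂⟩ h₂ (hy : y₁ = y₂)
        rw [mem_coe, mem_filter] at h₁ h₂
        have e₁ := h₁.2
        have e₂ := h₂.2
        simp only [Prod.mk.injEq] at e₁ e₂
        obtain ⟨rfl, rfl, rfl⟩ := e₁
        obtain ⟨rfl, rfl, rfl⟩ := e₂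
        rw [hy]
    refine hsub.trans ?_
    have hpmem : p ∈ (univ : Finset (Fin n)).filter (fun x => z.foldl (fun v c => μ c v) x = x) :=
      mem_filter.2 ⟨mem_univ _, hp⟩
    rw [card_erase_of_mem hpmem]
    exact Nat.sub_le_sub_right (hN z hz) 1
  -- every element of `S` lies over a return
  have hmap : ∀ t ∈ S, (t.1, t.2.1, t.2.2.1) ∈ Ret := by
    rintro ⟨z, d, p, y⟩ h
    rw [hS, mem_filter] at h
    obtain ⟨hmem, hd, hp, hpd, -, -⟩ := h
    simp only [mem_product, mem_univ, and_true, mem_range] at hmem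
    rw [hRet, mem_filter]
    simp only [mem_product, mem_univ, and_true, mem_range]
    exact ⟨hmem, hd, hp, hpd⟩
  calc S.card = ∑ r ∈ Ret, (S.filter (fun t => (t.1, t.2.1, t.2.2.1) = r)).card :=
        card_eq_sum_card_fiberwise hmap
    _ ≤ ∑ _r ∈ Ret, (N - 1) := sum_le_sum hfib
    _ = (N - 1) * Ret.card := by rw [sum_const, smul_eq_mul, mul_comm]

/-- **`Ret ≤ Σ_{d<ℓ} Σ_p cw_d(p) · cw_{ℓ−d}(p)`.**  A return `(z, d, p)` (`0 < d < ℓ`, `p · z = p`, `p · z.take d = p`) splits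
`z = z.take d ++ z.drop d` into two REDUCED words closed at `p`, of lengths `d` and `ℓ − d`; the splitting is injective. -/
theorem ret_le_sum (μ : Fin 3 → Equiv.Perm (Fin n)) (ℓ : ℕ) :
    (((((univ : Finset (List.Vector (Fin 3) ℓ)).image (fun v => v.toList)).filter
        (fun z => List.IsChain (· ≠ ·) (z ++ z))) ×ˢ range ℓ ×ˢ (univ : Finset (Fin n))).filter (fun t =>
          0 < t.2.1 ∧ t.1.foldl (fun v c => μ c v) t.2.2 = t.2.2 ∧
          (t.1.take t.2.1).foldl (fun v c => μ c v) t.2.2 = t.2.2)).card ≤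
      ∑ d ∈ range ℓ, ∑ p : Fin n,
        (((univ : Finset (List.Vector (Fin 3) d)).image (fun v => v.toList)).filter
            (fun g => List.IsChain (· ≠ ·) g ∧ g.foldl (fun v c => μ c v) p = p)).card *
          (((univ : Finset (List.Vector (Fin 3) (ℓ - d))).image (fun v => v.toList)).filter
            (fun g => List.IsChain (· ≠ ·) g ∧ g.foldl (fun v c => μ c v) p = p)).card := by
  classical
  set W := ((univ : Finset (List.Vector (Fin 3) ℓ)).image (fun v => v.toList)).filter
    (fun z => List.IsChain (· ≠ ·) (z ++ z)) with hW
  set Ret := ((W ×ˢ range ℓ ×ˢ (univ : Finset (Fin n))).filter (fun t =>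
    0 < t.2.1 ∧ t.1.foldl (fun v c => μ c v) t.2.2 = t.2.2 ∧
    (t.1.take t.2.1).foldl (fun v c => μ c v) t.2.2 = t.2.2)) with hRet
  -- `cw d p`, the reduced words of length `d` closing at `p`
  set cw : ℕ → Fin n → Finset (List (Fin 3)) := fun d p =>
    ((univ : Finset (List.Vector (Fin 3) d)).image (fun v => v.toList)).filter
      (fun g => List.IsChain (· ≠ ·) g ∧ g.foldl (fun v c => μ c v) p = p) with hcw
  have mem_cw : ∀ {d : ℕ} {p : Fin n} {g : List (Fin 3)},
      g ∈ cw d p ↔ g.length = d ∧ List.IsChain (· ≠ ·) g ∧ g.foldl (fun v c => μ c v) p = p := by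
    intro d p g
    rw [hcw, mem_filter, mem_words]
  -- target: the disjoint union over `(d, p)` of `cw d p × cw (ℓ - d) p`
  have htarget : (((range ℓ) ×ˢ (univ : Finset (Fin n))).sigma
      (fun dp => cw dp.1 dp.2 ×ˢ cw (ℓ - dp.1) dp.2)).card =
      ∑ d ∈ range ℓ, ∑ p : Fin n, (cw d p).card * (cw (ℓ - d) p).card := by
    rw [card_sigma, sum_product]
    simp only [card_product]
  show Ret.card ≤ ∑ d ∈ range ℓ, ∑ p : Fin n, (cw d p).card * (cw (ℓ - d) p).card
  rw [← htarget]
  refine card_le_card_of_injOn (fun t => ⟨(t.2.1, t.2.2), (t.1.take t.2.1, t.1.drop t.2.1)⟩) ?_ ?_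
  · rintro ⟨z, d, p⟩ h
    rw [mem_coe, hRet, mem_filter] at h
    obtain ⟨hmem, hd, hp, hpd⟩ := h
    simp only [mem_product, mem_univ, and_true, mem_range] at hmem
    obtain ⟨hz, hdℓ⟩ := hmem
    dsimp only at hd hp hpd hz hdℓ
    obtain ⟨hzl, hchain⟩ := mem_cycWords.1 hz
    have hred : List.IsChain (· ≠ ·) z := hchain.left_of_append
    simp only [mem_coe, mem_sigma, mem_product, mem_univ, and_true, mem_range]
    refine ⟨hdℓ, ?_, ?_⟩
    · rw [mem_cw]
      refine ⟨by rw [List.length_take]; omega, ?_, hpd⟩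
      rw [← List.take_append_drop d z] at hred
      exact hred.left_of_append
    · rw [mem_cw]
      refine ⟨by rw [List.length_drop, hzl], ?_, ?_⟩
      · rw [← List.take_append_drop d z] at hred
        exact hred.right_of_append
      · have h := hp
        rw [← List.take_append_drop d z, List.foldl_append, hpd] at h
        exact h
  · rintro ⟨z₁, d₁, p₁⟩ - ⟨z₂, d₂, p₂⟩ - heq
    simp only [Sigma.mk.injEq, Prod.mk.injEq] at heq
    obtain ⟨⟨rfl, rfl⟩, h⟩ := heq
    rw [heq_iff_eq, Prod.mk.injEq] at h
    obtain ⟨ht, hdr⟩ := h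
    have : z₁ = z₂ := by rw [← List.take_append_drop d₁ z₁, ht, hdr, List.take_append_drop]
    rw [this]

/-- **`RInc ≤ |R| · (M · (N − 1))`.**  A twin pre-pair based in `R` is `(z, x, y)` with `x ∈ R`, `z` one of the `≤ M` cyclically
reduced words of length `ℓ` closing at `x`, and `y` one of the `≤ N − 1` other fixed points of `z`. -/
theorem rinc_le (μ : Fin 3 → Equiv.Perm (Fin n)) (R : Finset (Fin n)) (ℓ N M : ℕ)
    (hN : ∀ z ∈ ((univ : Finset (List.Vector (Fin 3) ℓ)).image (fun v => v.toList)).filter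
        (fun z => List.IsChain (· ≠ ·) (z ++ z)),
      ((univ : Finset (Fin n)).filter (fun x => z.foldl (fun v c => μ c v) x = x)).card ≤ N)
    (hM : ∀ x : Fin n, ((((univ : Finset (List.Vector (Fin 3) ℓ)).image (fun v => v.toList)).filter
        (fun z => List.IsChain (· ≠ ·) (z ++ z))).filter (fun z => z.foldl (fun v c => μ c v) x = x)).card ≤ M) :
    (((((univ : Finset (List.Vector (Fin 3) ℓ)).image (fun v => v.toList)).filter
        (fun z => List.IsChain (· ≠ ·) (z ++ z))) ×ˢ (univ : Finset (Fin n)) ×ˢ (univ : Finset (Fin n))).filter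
        (fun t => t.1.foldl (fun v c => μ c v) t.2.1 = t.2.1 ∧ t.1.foldl (fun v c => μ c v) t.2.2 = t.2.2 ∧
          t.2.1 ≠ t.2.2 ∧ t.2.1 ∈ R)).card ≤ R.card * (M * (N - 1)) := by
  classical
  set W := ((univ : Finset (List.Vector (Fin 3) ℓ)).image (fun v => v.toList)).filter
    (fun z => List.IsChain (· ≠ ·) (z ++ z)) with hW
  set S := ((W ×ˢ (univ : Finset (Fin n)) ×ˢ (univ : Finset (Fin n))).filter
    (fun t => t.1.foldl (fun v c => μ c v) t.2.1 = t.2.1 ∧ t.1.foldl (fun v c => μ c v) t.2.2 = t.2.2 ∧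
      t.2.1 ≠ t.2.2 ∧ t.2.1 ∈ R)) with hS
  -- fibre over the base point `x ∈ R`, then over the word `z`
  have hmap : ∀ t ∈ S, t.2.1 ∈ R := fun t ht => (mem_filter.1 ht).2.2.2.2
  have hfib : ∀ x ∈ R, (S.filter (fun t => t.2.1 = x)).card ≤ M * (N - 1) := by
    intro x hx
    set Sx := S.filter (fun t => t.2.1 = x) with hSx
    set Wx := W.filter (fun z => z.foldl (fun v c => μ c v) x = x) with hWx
    have hmap' : ∀ t ∈ Sx, t.1 ∈ Wx := by
      rintro ⟨z, x', y⟩ h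
      rw [hSx, mem_filter, hS, mem_filter] at h
      obtain ⟨⟨hmem, hxf, -, -, -⟩, hx'⟩ := h
      simp only [mem_product, mem_univ, and_true] at hmem
      dsimp only at hxf hx'
      subst hx'
      exact mem_filter.2 ⟨hmem, hxf⟩
    have hfib' : ∀ z ∈ Wx, (Sx.filter (fun t => t.1 = z)).card ≤ N - 1 := by
      intro z hz
      have hzW : z ∈ W := (mem_filter.1 hz).1
      have hzx : z.foldl (fun v c => μ c v) x = x := (mem_filter.1 hz).2
      have hsub : (Sx.filter (fun t => t.1 = z)).card ≤
          (((univ : Finset (Fin n)).filter (fun v => z.foldl (fun v c => μ c v) v = v)).erase x).card := by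
        refine card_le_card_of_injOn (fun t => t.2.2) ?_ ?_
        · rintro ⟨z', x', y⟩ h
          rw [mem_coe, mem_filter, hSx, mem_filter, hS, mem_filter] at h
          obtain ⟨⟨⟨-, -, hy, hxy, -⟩, hx'⟩, hz'⟩ := h
          dsimp only at hy hxy hx' hz' ⊢
          subst hx' hz'
          rw [mem_coe, mem_erase, mem_filter]
          exact ⟨fun h => hxy h.symm, mem_univ _, hy⟩
        · rintro ⟨z₁, x₁, y₁⟩ h₁ ⟨z₂, x₂, y₂⟩ h₂ (hy : y₁ = y₂)
          rw [mem_coe, mem_filter, hSx, mem_filter] at h₁ h₂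
          obtain ⟨⟨-, h1x⟩, h1z⟩ := h₁
          obtain ⟨⟨-, h2x⟩, h2z⟩ := h₂
          dsimp only at h1x h1z h2x h2z
          rw [h1z, h2z, h1x, h2x, hy]
      refine hsub.trans ?_
      have hxmem : x ∈ (univ : Finset (Fin n)).filter (fun v => z.foldl (fun v c => μ c v) v = v) :=
        mem_filter.2 ⟨mem_univ _, hzx⟩
      rw [card_erase_of_mem hxmem]
      exact Nat.sub_le_sub_right (hN z hzW) 1
    calc Sx.card = ∑ z ∈ Wx, (Sx.filter (fun t => t.1 = z)).card := card_eq_sum_card_fiberwise hmap'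
      _ ≤ ∑ _z ∈ Wx, (N - 1) := sum_le_sum hfib'
      _ = Wx.card * (N - 1) := by rw [sum_const, smul_eq_mul]
      _ ≤ M * (N - 1) := Nat.mul_le_mul_right _ (hM x)
  calc S.card = ∑ x ∈ R, (S.filter (fun t => t.2.1 = x)).card := card_eq_sum_card_fiberwise hmap
    _ ≤ ∑ _x ∈ R, M * (N - 1) := sum_le_sum hfib
    _ = R.card * (M * (N - 1)) := by rw [sum_const, smul_eq_mul]

/-- **`Dp ≤ M · (N − 1)`.**  The twin pre-pairs based at a vertex `v` are `(z, y)` with `z` one of the `≤ M` cyclically reduced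
words of length `ℓ` closing at `v` and `y` one of the `≤ N − 1` other fixed points of `z`. -/
theorem pv_le (μ : Fin 3 → Equiv.Perm (Fin n)) (ℓ N M : ℕ) (v : Fin n)
    (hN : ∀ z ∈ ((univ : Finset (List.Vector (Fin 3) ℓ)).image (fun v => v.toList)).filter
        (fun z => List.IsChain (· ≠ ·) (z ++ z)),
      ((univ : Finset (Fin n)).filter (fun x => z.foldl (fun v c => μ c v) x = x)).card ≤ N)
    (hM : ((((univ : Finset (List.Vector (Fin 3) ℓ)).image (fun v => v.toList)).filter
        (fun z => List.IsChain (· ≠ ·) (z ++ z))).filter (fun z => z.foldl (fun v c => μ c v) v = v)).card ≤ M) :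
    (((((univ : Finset (List.Vector (Fin 3) ℓ)).image (fun v => v.toList)).filter
        (fun z => List.IsChain (· ≠ ·) (z ++ z))) ×ˢ (univ : Finset (Fin n))).filter (fun t =>
          t.1.foldl (fun v c => μ c v) v = v ∧ t.1.foldl (fun v c => μ c v) t.2 = t.2 ∧ v ≠ t.2)).card ≤
      M * (N - 1) := by
  classical
  set W := ((univ : Finset (List.Vector (Fin 3) ℓ)).image (fun v => v.toList)).filter
    (fun z => List.IsChain (· ≠ ·) (z ++ z)) with hW
  set S := ((W ×ˢ (univ : Finset (Fin n))).filter (fun t =>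
    t.1.foldl (fun v c => μ c v) v = v ∧ t.1.foldl (fun v c => μ c v) t.2 = t.2 ∧ v ≠ t.2)) with hS
  set Wv := W.filter (fun z => z.foldl (fun v c => μ c v) v = v) with hWv
  have hmap : ∀ t ∈ S, t.1 ∈ Wv := by
    rintro ⟨z, y⟩ h
    rw [hS, mem_filter] at h
    obtain ⟨hmem, hvf, -, -⟩ := h
    simp only [mem_product, mem_univ, and_true] at hmem
    exact mem_filter.2 ⟨hmem, hvf⟩
  have hfib : ∀ z ∈ Wv, (S.filter (fun t => t.1 = z)).card ≤ N - 1 := by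
    intro z hz
    have hzW : z ∈ W := (mem_filter.1 hz).1
    have hzv : z.foldl (fun v c => μ c v) v = v := (mem_filter.1 hz).2
    have hsub : (S.filter (fun t => t.1 = z)).card ≤
        (((univ : Finset (Fin n)).filter (fun x => z.foldl (fun v c => μ c v) x = x)).erase v).card := by
      refine card_le_card_of_injOn (fun t => t.2) ?_ ?_
      · rintro ⟨z', y⟩ h
        rw [mem_coe, mem_filter, hS, mem_filter] at h
        obtain ⟨⟨-, -, hy, hvy⟩, hz'⟩ := h
        dsimp only at hy hvy hz' ⊢
        subst hz'
        rw [mem_coe, mem_erase, mem_filter]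
        exact ⟨fun h => hvy h.symm, mem_univ _, hy⟩
      · rintro ⟨z₁, y₁⟩ h₁ ⟨z₂, y₂⟩ h₂ (hy : y₁ = y₂)
        rw [mem_coe, mem_filter] at h₁ h₂
        have e₁ := h₁.2
        have e₂ := h₂.2
        dsimp only at e₁ e₂
        rw [e₁, e₂, hy]
    refine hsub.trans ?_
    have hvmem : v ∈ (univ : Finset (Fin n)).filter (fun x => z.foldl (fun v c => μ c v) x = x) :=
      mem_filter.2 ⟨mem_univ _, hzv⟩
    rw [card_erase_of_mem hvmem]
    exact Nat.sub_le_sub_right (hN z hzW) 1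
  calc S.card = ∑ z ∈ Wv, (S.filter (fun t => t.1 = z)).card := card_eq_sum_card_fiberwise hmap
    _ ≤ ∑ _z ∈ Wv, (N - 1) := sum_le_sum hfib
    _ = Wv.card * (N - 1) := by rw [sum_const, smul_eq_mul]
    _ ≤ M * (N - 1) := Nat.mul_le_mul_right _ hM

/-- **Registered form** (`stub_twinReturnBound`, a `--supports` sub-goal of crux stmt-MatrixMultiplication-10883): the secondary
count `S₁` of the twins ℓ² reduction is at most `(N − 1) · Σ_{d<ℓ} Σ_p cw_d(p)·cw_{ℓ−d}(p)` whenever every cyclically reduced word of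
length `ℓ` has at most `N` fixed points (`s1_le_ret` + `ret_le_sum`). -/
theorem stub_twinReturnBound : ∀ (n ℓ N : ℕ) (μ : Fin 3 → Equiv.Perm (Fin n)), (∀ z ∈ (((Finset.univ : Finset (List.Vector (Fin 3) ℓ)).image (fun v => v.toList)).filter (fun z => List.IsChain (· ≠ ·) (z ++ z))), ((Finset.univ : Finset (Fin n)).filter (fun x => z.foldl (fun v c => μ c v) x = x)).card ≤ N) → (((((Finset.univ : Finset (List.Vector (Fin 3) ℓ)).image (fun v => v.toList)).filter (fun z => List.IsChain (· ≠ ·) (z ++ z))) ×ˢ Finset.range ℓ ×ˢ (Finset.univ : Finset (Fin n)) ×ˢ (Finset.univ : Finset (Fin n))).filter (fun t => 0 < t.2.1 ∧ t.1.foldl (fun v c => μ c v) t.2.2.1 = t.2.2.1 ∧ (t.1.take t.2.1).foldl (fun v c => μ c v) t.2.2.1 = t.2.2.1 ∧ t.1.foldl (fun v c => μ c v) t.2.2.2 = t.2.2.2 ∧ t.2.2.2 ≠ t.2.2.1)).card ≤ (N - 1) * ∑ d ∈ Finset.range ℓ, ∑ p : Fin n, (((Finset.univ : Finset (List.Vector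 (Fin 3) d)).image (fun v => v.toList)).filter (fun g => List.IsChain (· ≠ ·) g ∧ g.foldl (fun v c => μ c v) p = p)).card * (((Finset.univ : Finset (List.Vector (Fin 3) (ℓ - d))).image (fun v => v.toList)).filter (fun g => List.IsChain (· ≠ ·) g ∧ g.foldl (fun v c => μ c v) p = p)).card :=
  fun _ ℓ N μ hN => (s1_le_ret μ ℓ N hN).trans (Nat.mul_le_mul_left _ (ret_le_sum μ ℓ))

end TwinsEll2

end Summit.MatrixMultiplication.MatrixMultiplication.Theorems.HyperoctahedralThreshold
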